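import Literature.Analysis.FluidPDE.SereginLocalStokesRegularity
import HarnessLib

/-!
# Mixed norms on parabolic cylinders: homogeneity, Minkowski, and the `L¹`-Morrey bound

Analysis/FluidPDE support file (everything proved) on the decomposition path of the named fact
`Literature.Analysis.FluidPDE.ParabolicSobolevHolderEmbedding` (Seregin 2014, §4.6, Prop. 6.8:
`W^{2,1}_{s,n}(Q) ⊂ C^μ(Q̄(1/2))`, `μ = 2 - 2/n - 3/s`). The planned discharge represents the
localised function as the heat potential of `f = (∂ₜ - Δ)(φv) ∈ L_{s,n}` and feeds the tree's
abstract Hölder theorem for parabolic singular potentials of `L¹`-Morrey data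
(`parabolicHolderOnWith_integral_of_kernel_bounds`, `ParabolicSingularPotentials.lean`). This file
supplies the real-variable facts about the mixed norm
`mixedNorm s n z R F = ‖F‖_{s,n,Q(z,R)} = (∫_{t-R²}^{t} (∫_{B(x,R)} |F|ˢ)^{n/s})^{1/n}` of
`SereginLocalStokesRegularity.lean` that this requires, for `ℝ≥0∞`-valued measurable integrands
(apply them to `w ↦ ‖F w‖ₑ`, `mixedNorm_enorm`):

* `mixedNorm_const_mul` — homogeneity `‖c Φ‖_{s,n} = c ‖Φ‖_{s,n}`;
* `mixedNorm_add_le` — Minkowski's inequality `‖Φ₁ + Φ₂‖_{s,n} ≤ ‖Φ₁‖_{s,n} + ‖Φ₂‖_{s,n}`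
  (`1 ≤ s`, `1 ≤ n`; Minkowski in `L_s(B)` slice-wise, then in `L_n` in time);
* `exists_lintegral_parabolicCylinderCentered_le_mixedNorm` — **the `L¹`-Morrey bound of
  `L_{s,n}` data**: for `1 < s`, `1 < n` there is `C₀ = C₀(s,n) > 0` (`|B₁|^{1-1/s} 2^{1-1/n}`) such
  that for every measurable `Φ ≥ 0` vanishing off `Q(z,R)` and every centred cylinder
  `Q*_ρ(c) = ]c₁ - ρ², c₁ + ρ²[ × B(c₂, ρ)`,
  `∫∫_{Q*_ρ(c)} Φ ≤ ‖Φ‖_{s,n,Q(z,R)} · C₀ ρ^{5 - 3/s - 2/n}` (Hölder's inequality in `L_s(B(c₂,ρ))`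
  and in `L_n(]c₁ - ρ², c₁ + ρ²[)`, `|B(c₂,ρ)| = |B₁| ρ³`); in particular `L_{s,n}(Q(z,R)) ⊂ L¹`
  (`lintegral_parabolicCylinder_le_mixedNorm`). With `d = 5 - 3/s - 2/n = 3 + μ` this is the Morrey
  exponent for which the heat kernel (`m = 3`) gives Hölder exponent `d - m = μ`.

## References

* G. Seregin, *Lecture notes on regularity theory for the Navier–Stokes equations*, World
  Scientific (2014), §4.4 (mixed norms), §4.6 Prop. 6.8. [`Seregin2014`]
* P. G. Lemarié-Rieusset, *The Navier–Stokes Problem in the 21st Century* (2016), §13.8 p. 462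
  (parabolic Morrey classes). [`LemarieRieusset2016`]
-/

noncomputable section

open MeasureTheory TopologicalSpace Set Function Metric Filter
open scoped ENNReal NNReal Topology

namespace Literature.Analysis.FluidPDE

/-! ### Reduction to `ℝ≥0∞`-valued integrands and homogeneity -/

section General

variable {X : Type*} [PseudoMetricSpace X] [MeasureSpace X]

/-- The mixed norm of `F` is the mixed norm of the scalar function `w ↦ ‖F w‖ₑ`. [folklore] -/
theorem mixedNorm_enorm {α : Type*} [ENorm α] (s n : ℝ) (z : ℝ × X) (R : ℝ) (F : ℝ × X → α) :
    mixedNorm s n z R (fun w => ‖F w‖ₑ) = mixedNorm s n z R F := by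
  simp only [mixedNorm, enorm_eq_self]

/-- **Homogeneity** of the mixed norm for `ℝ≥0∞`-valued integrands: `‖c Φ‖_{s,n} = c ‖Φ‖_{s,n}`
(`c < ∞`, `0 < s`, `0 < n`). [folklore] -/
theorem mixedNorm_const_mul {s n : ℝ} (hs : 0 < s) (hn : 0 < n) (z : ℝ × X) (R : ℝ)
    {c : ℝ≥0∞} (hc : c ≠ ∞) (Φ : ℝ × X → ℝ≥0∞) :
    mixedNorm s n z R (fun w => c * Φ w) = c * mixedNorm s n z R Φ := by
  unfold mixedNorm
  simp only [enorm_eq_self]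
  have hcs : c ^ s ≠ ∞ := ENNReal.rpow_ne_top_of_nonneg hs.le hc
  have hcn : c ^ n ≠ ∞ := ENNReal.rpow_ne_top_of_nonneg hn.le hc
  have h1 : ∀ t, (∫⁻ x in ball z.2 R, (c * Φ (t, x)) ^ s) ^ (n / s) =
      c ^ n * (∫⁻ x in ball z.2 R, Φ (t, x) ^ s) ^ (n / s) := by
    intro t
    simp_rw [ENNReal.mul_rpow_of_nonneg _ _ hs.le]
    rw [lintegral_const_mul' _ _ hcs, ENNReal.mul_rpow_of_nonneg _ _ (by positivity),
      ← ENNReal.rpow_mul, mul_div_cancel₀ _ hs.ne']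
  simp_rw [h1]
  rw [lintegral_const_mul' _ _ hcn, ENNReal.mul_rpow_of_nonneg _ _ (by positivity),
    ← ENNReal.rpow_mul, mul_one_div_cancel hn.ne', ENNReal.rpow_one]

end General

/-! ### Minkowski's inequality -/

section Slice

variable {X : Type*} [MeasurableSpace X]

/-- Slices of a measurable function on `ℝ × X` are measurable. [folklore] -/
theorem measurable_slice_right {Φ : ℝ × X → ℝ≥0∞} (hΦ : Measurable Φ) (t : ℝ) :
    Measurable fun x => Φ (t, x) :=
  hΦ.comp measurable_prodMk_left

end Slice

section MinkowskiVolume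

variable {X : Type*} [PseudoMetricSpace X] [MeasureSpace X] [SFinite (volume : Measure X)]

/-- **Minkowski's inequality for mixed norms**: `‖Φ₁ + Φ₂‖_{s,n,Q(z,R)} ≤ ‖Φ₁‖_{s,n,Q(z,R)} +
‖Φ₂‖_{s,n,Q(z,R)}` for measurable `ℝ≥0∞`-valued integrands and `1 ≤ s`, `1 ≤ n` (Minkowski in
`L_s(B(x,R))` for each time, then in `L_n(]t - R², t[)`; Seregin 2014, §4.4: `L_{s,l}(Q_T) =
L_l(0,T; L_s(Ω))` is a normed space). [folklore] -/
theorem mixedNorm_add_le {s n : ℝ} (hs : 1 ≤ s) (hn : 1 ≤ n) (z : ℝ × X) (R : ℝ)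
    {Φ₁ Φ₂ : ℝ × X → ℝ≥0∞} (h₁ : Measurable Φ₁) (h₂ : Measurable Φ₂) :
    mixedNorm s n z R (fun w => Φ₁ w + Φ₂ w) ≤ mixedNorm s n z R Φ₁ + mixedNorm s n z R Φ₂ := by
  have hs0 : 0 < s := by linarith
  have hn0 : 0 < n := by linarith
  unfold mixedNorm
  simp only [enorm_eq_self]
  -- the slice-wise `L_s` quantities
  set A₁ : ℝ → ℝ≥0∞ := fun t => (∫⁻ x in ball z.2 R, Φ₁ (t, x) ^ s) ^ (1 / s) with hA₁
  set A₂ : ℝ → ℝ≥0∞ := fun t => (∫⁻ x in ball z.2 R, Φ₂ (t, x) ^ s) ^ (1 / s) with hA₂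
  have hA₁m : Measurable A₁ :=
    ((h₁.pow_const s).lintegral_prod_right' (ν := volume.restrict (ball z.2 R))).pow_const _
  have hA₂m : Measurable A₂ :=
    ((h₂.pow_const s).lintegral_prod_right' (ν := volume.restrict (ball z.2 R))).pow_const _
  have hpow : ∀ a : ℝ≥0∞, a ^ (n / s) = (a ^ (1 / s)) ^ n := fun a => by
    rw [← ENNReal.rpow_mul, one_div_mul_eq_div]
  -- Minkowski in space, for every time
  have hslice : ∀ t, (∫⁻ x in ball z.2 R, (Φ₁ (t, x) + Φ₂ (t, x)) ^ s) ^ (n / s) ≤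
      (A₁ t + A₂ t) ^ n := by
    intro t
    rw [hpow]
    refine ENNReal.rpow_le_rpow ?_ hn0.le
    exact ENNReal.lintegral_Lp_add_le (measurable_slice_right h₁ t).aemeasurable
      (measurable_slice_right h₂ t).aemeasurable hs
  -- Minkowski in time
  calc (∫⁻ t in Ioo (z.1 - R ^ 2) z.1,
          (∫⁻ x in ball z.2 R, (Φ₁ (t, x) + Φ₂ (t, x)) ^ s) ^ (n / s)) ^ (1 / n)
      ≤ (∫⁻ t in Ioo (z.1 - R ^ 2) z.1, (A₁ t + A₂ t) ^ n) ^ (1 / n) :=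
        ENNReal.rpow_le_rpow (lintegral_mono fun t => hslice t) (by positivity)
    _ ≤ (∫⁻ t in Ioo (z.1 - R ^ 2) z.1, A₁ t ^ n) ^ (1 / n) +
          (∫⁻ t in Ioo (z.1 - R ^ 2) z.1, A₂ t ^ n) ^ (1 / n) :=
        ENNReal.lintegral_Lp_add_le hA₁m.aemeasurable hA₂m.aemeasurable hn
    _ = _ := by simp only [hA₁, hA₂, ← hpow]

/-- Minkowski's inequality under pointwise domination on the cylinder: if
`‖F w‖ₑ ≤ Φ₁ w + Φ₂ w` on `Q(z,R)` with `Φ₁, Φ₂` measurable, then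
`‖F‖_{s,n,Q(z,R)} ≤ ‖Φ₁‖_{s,n,Q(z,R)} + ‖Φ₂‖_{s,n,Q(z,R)}` (`1 ≤ s`, `1 ≤ n`). [folklore] -/
theorem mixedNorm_le_add_of_enorm_le [OpensMeasurableSpace X] {α : Type*} [ENorm α] {s n : ℝ}
    (hs : 1 ≤ s) (hn : 1 ≤ n)
    (z : ℝ × X) (R : ℝ) {F : ℝ × X → α} {Φ₁ Φ₂ : ℝ × X → ℝ≥0∞} (h₁ : Measurable Φ₁)
    (h₂ : Measurable Φ₂) (h : ∀ w ∈ parabolicCylinder R z, ‖F w‖ₑ ≤ Φ₁ w + Φ₂ w) :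
    mixedNorm s n z R F ≤ mixedNorm s n z R Φ₁ + mixedNorm s n z R Φ₂ :=
  (mixedNorm_mono (F' := fun w => Φ₁ w + Φ₂ w) (by linarith) (by linarith)
    (fun w hw => by simpa only [enorm_eq_self] using h w hw)).trans
    (mixedNorm_add_le hs hn z R h₁ h₂)

end MinkowskiVolume

/-! ### The `L¹`-Morrey bound of `L_{s,n}` data -/

section Morrey

/-- **`L¹`-Morrey bound of `L_{s,n}` data** (Hölder's inequality twice): for `1 < s`, `1 < n` there
is `C₀ = C₀(s,n) > 0` such that for every measurable `Φ : ℝ × ℝ³ → ℝ≥0∞` vanishing off the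
cylinder `Q(z,R)`, every centre `c` and radius `ρ > 0`,
`∫∫_{Q*_ρ(c)} Φ ≤ ‖Φ‖_{s,n,Q(z,R)} · C₀ ρ^{5 - 3/s - 2/n}`,
`Q*_ρ(c) = ]c₁ - ρ², c₁ + ρ²[ × B(c₂, ρ)` the centred parabolic cylinder:
`∫_{B(c₂,ρ)} Φ(t,·) ≤ ‖Φ(t,·)‖_{L_s(B(x,R))} |B(c₂,ρ)|^{1-1/s}` and
`∫_{]c₁-ρ²,c₁+ρ²[} ‖Φ(t,·)‖_{L_s} dt ≤ ‖Φ‖_{s,n,Q(z,R)} (2ρ²)^{1-1/n}`, with `|B(c₂,ρ)| = |B₁| ρ³`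
(Lemarié-Rieusset 2016, p. 462: `L^q_t L^p_x` data are parabolic-Morrey). [folklore] -/
theorem exists_lintegral_parabolicCylinderCentered_le_mixedNorm {s n : ℝ} (hs : 1 < s)
    (hn : 1 < n) : ∃ C₀ : ℝ, 0 < C₀ ∧ ∀ (z : ℝ × EuclideanSpace ℝ (Fin 3)) (R : ℝ)
      (Φ : ℝ × EuclideanSpace ℝ (Fin 3) → ℝ≥0∞), Measurable Φ →
      (∀ w ∉ parabolicCylinder R z, Φ w = 0) → ∀ (c : ℝ × EuclideanSpace ℝ (Fin 3)) (ρ : ℝ),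
      0 < ρ →
        ∫⁻ w in parabolicCylinderCentered ρ c, Φ w ≤
          mixedNorm s n z R Φ * ENNReal.ofReal (C₀ * ρ ^ (5 - 3 / s - 2 / n)) := by
  have hs0 : 0 < s := by linarith
  have hn0 : 0 < n := by linarith
  -- conjugate exponents
  have hsc : s.HolderConjugate (s / (s - 1)) := (Real.holderConjugate_iff_eq_conjExponent hs).2 rfl
  have hnc : n.HolderConjugate (n / (n - 1)) := (Real.holderConjugate_iff_eq_conjExponent hn).2 rfl
  have hs' : 1 / (s / (s - 1)) = 1 - 1 / s := by field_simp
  have hn' : 1 / (n / (n - 1)) = 1 - 1 / n := by field_simp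
  have hs1 : 0 ≤ 1 - 1 / s := by
    rw [sub_nonneg, div_le_one hs0]; exact hs.le
  have hn1 : 0 ≤ 1 - 1 / n := by
    rw [sub_nonneg, div_le_one hn0]; exact hn.le
  -- the volume of the unit ball
  set V₁ : ℝ := (volume (ball (0 : EuclideanSpace ℝ (Fin 3)) 1)).toReal with hV₁
  have hV₁pos : 0 < V₁ := by
    rw [hV₁]
    exact ENNReal.toReal_pos (measure_ball_pos volume (0 : EuclideanSpace ℝ (Fin 3)) one_pos).ne'
      measure_ball_lt_top.ne
  have hV₁eq : volume (ball (0 : EuclideanSpace ℝ (Fin 3)) 1) = ENNReal.ofReal V₁ := by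
    rw [hV₁, ENNReal.ofReal_toReal measure_ball_lt_top.ne]
  refine ⟨V₁ ^ (1 - 1 / s) * 2 ^ (1 - 1 / n), by positivity, fun z R Φ hΦ hΦ0 c ρ hρ => ?_⟩
  -- notation
  set I : Set ℝ := Ioo (z.1 - R ^ 2) z.1 with hI
  set B : Set (EuclideanSpace ℝ (Fin 3)) := ball z.2 R with hB
  set Is : Set ℝ := Ioo (c.1 - ρ ^ 2) (c.1 + ρ ^ 2) with hIs
  set Bs : Set (EuclideanSpace ℝ (Fin 3)) := ball c.2 ρ with hBs
  set A : ℝ → ℝ≥0∞ := fun t => (∫⁻ y in B, Φ (t, y) ^ s) ^ (1 / s) with hA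
  have hAm : Measurable A :=
    ((hΦ.pow_const s).lintegral_prod_right' (ν := volume.restrict B)).pow_const _
  -- `Φ(t,·)` vanishes off `B`, and `A` vanishes off `I`
  have hΦ0' : ∀ t y, Φ (t, y) ≠ 0 → t ∈ I ∧ y ∈ B := by
    intro t y h
    by_contra hc
    exact h (hΦ0 (t, y) fun hm => hc (mem_prod.1 hm))
  -- the volumes of the centred cylinder
  have hvolB : volume Bs = ENNReal.ofReal (V₁ * ρ ^ 3) := by
    rw [hBs, Measure.addHaar_ball_of_pos volume c.2 hρ, finrank_euclideanSpace_fin, hV₁eq,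
      ← ENNReal.ofReal_mul (by positivity), mul_comm]
  have hvolI : volume Is = ENNReal.ofReal (2 * ρ ^ 2) := by
    rw [hIs, Real.volume_Ioo]; congr 1; ring
  -- Hölder in space, for every time
  have hspace : ∀ t, ∫⁻ y in Bs, Φ (t, y) ≤
      A t * ENNReal.ofReal ((V₁ * ρ ^ 3) ^ (1 - 1 / s)) := by
    intro t
    have hH := ENNReal.lintegral_mul_le_Lp_mul_Lq (volume.restrict Bs) hsc
      (measurable_slice_right hΦ t).aemeasurable (g := fun _ => 1) aemeasurable_const
    simp only [Pi.mul_apply, mul_one, ENNReal.one_rpow, lintegral_const, Measure.restrict_apply,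
      MeasurableSet.univ, univ_inter, one_mul] at hH
    refine hH.trans (mul_le_mul' ?_ ?_)
    · -- `∫_{Bs} Φ(t,·)^s ≤ ∫_{B} Φ(t,·)^s`
      refine ENNReal.rpow_le_rpow ?_ (by positivity)
      calc ∫⁻ y in Bs, Φ (t, y) ^ s ≤ ∫⁻ y, Φ (t, y) ^ s := setLIntegral_le_lintegral _ _
        _ = ∫⁻ y in B, Φ (t, y) ^ s := by
            refine (setLIntegral_eq_of_support_subset fun y hy => ?_).symm
            have : Φ (t, y) ≠ 0 := fun h => hy (by simp [h, ENNReal.zero_rpow_of_pos hs0])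
            exact (hΦ0' t y this).2
    · rw [hvolB, hs', ENNReal.ofReal_rpow_of_nonneg (by positivity) hs1]
  -- Hölder in time
  have htime : ∫⁻ t in Is, A t ≤
      (∫⁻ t in I, (∫⁻ y in B, Φ (t, y) ^ s) ^ (n / s)) ^ (1 / n) *
        ENNReal.ofReal ((2 * ρ ^ 2) ^ (1 - 1 / n)) := by
    have hH := ENNReal.lintegral_mul_le_Lp_mul_Lq (volume.restrict Is) hnc
      hAm.aemeasurable (g := fun _ => 1) aemeasurable_const
    simp only [Pi.mul_apply, mul_one, ENNReal.one_rpow, lintegral_const, Measure.restrict_apply,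
      MeasurableSet.univ, univ_inter, one_mul] at hH
    refine hH.trans (mul_le_mul' ?_ ?_)
    · refine ENNReal.rpow_le_rpow ?_ (by positivity)
      have hpow : ∀ t, A t ^ n = (∫⁻ y in B, Φ (t, y) ^ s) ^ (n / s) := fun t => by
        rw [hA, ← ENNReal.rpow_mul, one_div_mul_eq_div]
      calc ∫⁻ t in Is, A t ^ n ≤ ∫⁻ t, A t ^ n := setLIntegral_le_lintegral _ _
        _ = ∫⁻ t in I, A t ^ n := by
            refine (setLIntegral_eq_of_support_subset fun t ht => ?_).symm
            have hAt : A t ≠ 0 := fun h => ht (by simp [h, ENNReal.zero_rpow_of_pos hn0])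
            have : ∫⁻ y in B, Φ (t, y) ^ s ≠ 0 := fun h => hAt (by simp [hA, h, hs0])
            obtain ⟨y, -, hy⟩ : ∃ y ∈ B, Φ (t, y) ^ s ≠ 0 := by
              by_contra hc
              push Not at hc
              refine this ?_
              rw [setLIntegral_congr_fun measurableSet_ball hc, lintegral_zero]
            have hy' : Φ (t, y) ≠ 0 := fun h => hy (by simp [h, ENNReal.zero_rpow_of_pos hs0])
            exact (hΦ0' t y hy').1
        _ = ∫⁻ t in I, (∫⁻ y in B, Φ (t, y) ^ s) ^ (n / s) := by simp only [hpow]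
    · rw [hvolI, hn', ENNReal.ofReal_rpow_of_nonneg (by positivity) hn1]
  -- assemble
  have hprod : ∫⁻ w in parabolicCylinderCentered ρ c, Φ w = ∫⁻ t in Is, ∫⁻ y in Bs, Φ (t, y) := by
    rw [parabolicCylinderCentered, Measure.volume_eq_prod, ← Measure.prod_restrict,
      lintegral_prod _ hΦ.aemeasurable]
  rw [hprod]
  calc ∫⁻ t in Is, ∫⁻ y in Bs, Φ (t, y)
      ≤ ∫⁻ t in Is, A t * ENNReal.ofReal ((V₁ * ρ ^ 3) ^ (1 - 1 / s)) :=
        lintegral_mono fun t => hspace t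
    _ = (∫⁻ t in Is, A t) * ENNReal.ofReal ((V₁ * ρ ^ 3) ^ (1 - 1 / s)) :=
        lintegral_mul_const _ hAm
    _ ≤ (∫⁻ t in I, (∫⁻ y in B, Φ (t, y) ^ s) ^ (n / s)) ^ (1 / n) *
          ENNReal.ofReal ((2 * ρ ^ 2) ^ (1 - 1 / n)) *
          ENNReal.ofReal ((V₁ * ρ ^ 3) ^ (1 - 1 / s)) := mul_le_mul' htime le_rfl
    _ = mixedNorm s n z R Φ *
          ENNReal.ofReal (V₁ ^ (1 - 1 / s) * 2 ^ (1 - 1 / n) * ρ ^ (5 - 3 / s - 2 / n)) := by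
        rw [mixedNorm, mul_assoc, ← ENNReal.ofReal_mul (by positivity)]
        simp only [enorm_eq_self]
        congr 2
        rw [Real.mul_rpow (by norm_num) (by positivity), Real.mul_rpow hV₁pos.le (by positivity),
          ← Real.rpow_natCast ρ 2, ← Real.rpow_natCast ρ 3, ← Real.rpow_mul hρ.le,
          ← Real.rpow_mul hρ.le]
        have : ρ ^ (5 - 3 / s - 2 / n) =
            ρ ^ ((2 : ℕ) * (1 - 1 / n)) * ρ ^ ((3 : ℕ) * (1 - 1 / s)) := by
          rw [← Real.rpow_add hρ]; congr 1; push_cast; ring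
        rw [this]; ring

/-- **`L_{s,n}(Q(z,R)) ⊂ L¹(Q(z,R))`** quantitatively: for measurable `Φ ≥ 0` vanishing off
`Q(z,R)`, `∫∫_{Q(z,R)} Φ ≤ ‖Φ‖_{s,n,Q(z,R)} C₀ R^{5 - 3/s - 2/n}` with the constant of
`exists_lintegral_parabolicCylinderCentered_le_mixedNorm` (`Q(z,R) ⊆ Q*_R(z)`). [folklore] -/
theorem lintegral_parabolicCylinder_le_mixedNorm {s n C₀ : ℝ}
    (hC₀ : ∀ (z : ℝ × EuclideanSpace ℝ (Fin 3)) (R : ℝ)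
      (Φ : ℝ × EuclideanSpace ℝ (Fin 3) → ℝ≥0∞), Measurable Φ →
      (∀ w ∉ parabolicCylinder R z, Φ w = 0) → ∀ (c : ℝ × EuclideanSpace ℝ (Fin 3)) (ρ : ℝ),
      0 < ρ →
        ∫⁻ w in parabolicCylinderCentered ρ c, Φ w ≤
          mixedNorm s n z R Φ * ENNReal.ofReal (C₀ * ρ ^ (5 - 3 / s - 2 / n)))
    (z : ℝ × EuclideanSpace ℝ (Fin 3)) {R : ℝ} (hR : 0 < R)
    {Φ : ℝ × EuclideanSpace ℝ (Fin 3) → ℝ≥0∞} (hΦ : Measurable Φ)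
    (hΦ0 : ∀ w ∉ parabolicCylinder R z, Φ w = 0) :
    ∫⁻ w in parabolicCylinder R z, Φ w ≤
      mixedNorm s n z R Φ * ENNReal.ofReal (C₀ * R ^ (5 - 3 / s - 2 / n)) :=
  (lintegral_mono_set (parabolicCylinder_subset_centered R z)).trans (hC₀ z R Φ hΦ hΦ0 z R hR)

end Morrey

end Literature.Analysis.FluidPDE

end
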